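import Summits.QuantumAdvantage.QuantumAdvantage.Theses.LinnikCubicClassGroups

/-!
# Crux `LinnikCubicClassGroups.PureCubicClassGroupFBQP` (stmt-QuantumAdvantage-11544) — stub `stub_semAffine`

Line `arakelov-giant-step-cycle`, registered stub `stub_semAffine` (S5b-P5b-A) of skeleton v18: the exact-affine shifts
`y_E = 2^s·fract(Y_E/R)` of the class table and their roundings (pure `Int.fract` arithmetic).
-/

set_option linter.dupNamespace false

namespace Summit.QuantumAdvantage.QuantumAdvantage.Theorems.LinnikCubicClassGroups

/-- **S5b-P5b-A `stub_semAffine`**: for `Y_E` affine modulo `R` along the classes (`Y_E' − Y_E + R Σ μ_t Δd_t ∈ Rℤ`), the shifts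
`y_E = 2^s fract(Y_E/R) ∈ [0, 2^s)` satisfy `y_E R/2^s ≡ Y_E (mod R)`, their floors `σ_E = ⌊y_E⌋ < 2^s` are within `1`, and
`y_E' − y_E + 2^s Σ μ_t Δd_t ∈ 2^s ℤ`. [folklore] -/
theorem stub_semAffine :
    ∀ (R : ℝ), 0 < R → ∀ (s T : ℕ) (Y : ℕ → ℝ) (μ : Fin T → ℝ) (d : ℕ → Fin T → ℝ) (cls : ℕ → ℕ),
      (∀ E E', cls E = cls E' → ∃ z : ℤ, Y E' - Y E + R * ∑ t, μ t * (d E' t - d E t) = z * R) →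
      (∀ E, 0 ≤ (2 : ℝ) ^ s * Int.fract (Y E / R) ∧ (2 : ℝ) ^ s * Int.fract (Y E / R) < (2 : ℝ) ^ s) ∧
      (∀ E, (⌊(2 : ℝ) ^ s * Int.fract (Y E / R)⌋₊ : ℝ) ≤ (2 : ℝ) ^ s * Int.fract (Y E / R) ∧
        (2 : ℝ) ^ s * Int.fract (Y E / R) < (⌊(2 : ℝ) ^ s * Int.fract (Y E / R)⌋₊ : ℝ) + 1) ∧
      (∀ E, ⌊(2 : ℝ) ^ s * Int.fract (Y E / R)⌋₊ < 2 ^ s) ∧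
      (∀ E, ∃ q : ℤ, (2 : ℝ) ^ s * Int.fract (Y E / R) * (R / ((2 ^ s : ℕ) : ℝ)) = Y E + q * R) ∧
      (∀ E E', cls E = cls E' → ∃ z : ℤ, (2 : ℝ) ^ s * Int.fract (Y E' / R) - (2 : ℝ) ^ s * Int.fract (Y E / R) +
        (2 : ℝ) ^ s * ∑ t, μ t * (d E' t - d E t) = (2 : ℝ) ^ s * z) := by
  intro R hR s T Y μ d cls haff
  have h2s : (0 : ℝ) < (2 : ℝ) ^ s := by positivity
  have hRne : R ≠ 0 := hR.ne'
  have hy0 : ∀ E, 0 ≤ (2 : ℝ) ^ s * Int.fract (Y E / R) := fun E =>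
    mul_nonneg h2s.le (Int.fract_nonneg _)
  have hy1 : ∀ E, (2 : ℝ) ^ s * Int.fract (Y E / R) < (2 : ℝ) ^ s := fun E => by
    calc (2 : ℝ) ^ s * Int.fract (Y E / R) < (2 : ℝ) ^ s * 1 := by
          gcongr
          exact Int.fract_lt_one _
      _ = (2 : ℝ) ^ s := mul_one _
  refine ⟨fun E => ⟨hy0 E, hy1 E⟩, fun E => ⟨Nat.floor_le (hy0 E), Nat.lt_floor_add_one _⟩,
    fun E => ?_, fun E => ?_, fun E E' hEE' => ?_⟩
  · rw [Nat.floor_lt (hy0 E)]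
    push_cast
    exact hy1 E
  · refine ⟨-⌊Y E / R⌋, ?_⟩
    unfold Int.fract
    push_cast
    field_simp
    ring
  · obtain ⟨z, hz⟩ := haff E E' hEE'
    refine ⟨z - ⌊Y E' / R⌋ + ⌊Y E / R⌋, ?_⟩
    have hsum : ∑ t, μ t * (d E' t - d E t) = z - (Y E' - Y E) / R := by
      rw [eq_sub_iff_add_eq, add_div' _ _ _ hRne, div_eq_iff hRne]
      linarith [hz]
    rw [hsum]
    unfold Int.fract
    push_cast
    field_simp
    ring

end Summit.QuantumAdvantage.QuantumAdvantage.Theorems.LinnikCubicClassGroups
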